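import Summits.CriticalPhenomena.PercolationContinuityZ3.Theorems.PercNearOneGluingNoHeavyLowerTailSelectionOrder
import Literature.Probability.Percolation.KozmaNitzanPreFKG
import HarnessLib

/-!
# `NoHeavyLowerTail` (stmt-CriticalPhenomena-4575) — the AVERAGED post-FKG inequality for `|A| = 2`
# (= the selection inequality SH1 / (SO_ρ) at `|A ∖ a₁| = 2`, top level), a theorem

Hull-port prover #4 (prim-hp-4 gen 5), 2026-08-19.  `μ = prodBernoulli w` on `Fin n`; vertices `o` (observer),
`b` (target), relays `a₁ ≠ a₂` labelled so that `a₁` is the LESS reliable one: `μ(a₁ ↔ b) ≤ μ(a₂ ↔ b)`.  Then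

  **`μ(o ↔ b, o ↔ {a₁,a₂}) ≥ μ(o ↔ a₁)·μ(a₁ ↔ b) + μ(o ↔ a₂, o ↮ a₁)·μ(a₂ ↔ b)`**   (`averagedPostFKG_pair`),

i.e. `μ(o ↔ b | o ↔ A) ≥ E[μ(W ↔ b)]` where `W` is the FIRST relay of `A = {a₁, a₂}` joined to `o` in the order
"least reliable first".  This lies strictly between Kozma–Nitzan's post-FKG Conjecture 1 at `|A| = 2`
(`μ(o↔b) ≥ μ(o↔A)·min_a μ(a↔b)`, their Theorem 1) and the false `max` form; with the opposite order it is false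
(path `o – a₂ – a₁ – b`).  PROOF: the four BHK inequalities of the printed proof of KN Theorem 1 (tree:
`KNPreFKG.bhk_one_upper_upper`, `bhk_two_upper_upper`, as in `KNPreFKG.preFKG_pair`) give KN's weighted form (6),
`(φ₁+φ₂)·μ(o↔b↔A) ≥ φ₁·μ(o↔A, a₁↔b) + φ₂·μ(o↔A, a₂↔b)` with `φᵢ = μ(o ↔ aᵢ, a₁ ↮ a₂)`; Harris bounds
`μ(o↔A, aᵢ↔b) ≥ μ(o↔A)μ(aᵢ↔b)`; and the first-reached weights `(μ(o↔a₁), φ₂)` put no more mass on the larger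
reliability than KN's `(φ₁, φ₂)` do, because `μ(o↔a₁) + φ₂ = μ(o↔A) ≥ φ₁ + φ₂`.
CONSEQUENCE (`selectionOrder_three`): the hypothesis (SO_ρ) of `SelectionOrder.avoidingMax_of_selectionOrder` HOLDS for
`|A| = 3` at levels `j ≥ 2` with the ranking "less reliable to `a₁` first" — the selection inequality SH1 of the
hull-port line (ttrl2 census `ig1`: 0 / 8.3·10⁷) is a THEOREM in its smallest open case.  No sorries, standard axioms.
-/

noncomputable section

namespace Summit.CriticalPhenomena.PercolationContinuityZ3.Theorems

open MeasureTheory Set Literature.Probability.LatticeModels Literature.Probability.Percolation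
open Literature.Probability.Percolation.KNPreFKG
open scoped Classical BigOperators

namespace SelectionOrder

variable {n : ℕ}

/-- **Averaged post-FKG inequality, `|A| = 2`.**  If `μ(a₁ ↔ b) ≤ μ(a₂ ↔ b)` and `a₁ ≠ a₂` then
`μ(o↔a₁)·μ(a₁↔b) + μ(o↔a₂, o↮a₁)·μ(a₂↔b) ≤ μ(o↔b, o↔{a₁,a₂})`.
[cite: KozmaNitzan2024, Thm. 1 (pp. 7–8), inequality (6); VandenbergHaggstromKahn2005, Thms. 1.3–1.4; this work] -/
theorem averagedPostFKG_pair (w : Sym2 (Fin n) → unitInterval) (o b a₁ a₂ : Fin n) (h12 : a₁ ≠ a₂)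
    (hp : (prodBernoulli w).real (openConn a₁ b) ≤ (prodBernoulli w).real (openConn a₂ b)) :
    (prodBernoulli w).real (openConn o a₁) * (prodBernoulli w).real (openConn a₁ b) +
        (prodBernoulli w).real (openConn o a₂ ∩ (openConn o a₁)ᶜ) * (prodBernoulli w).real (openConn a₂ b) ≤
      (prodBernoulli w).real (openConn o b ∩ (openConn o a₁ ∪ openConn o a₂)) := by
  set μ := prodBernoulli w with hμ
  set O₁ : Set (BondConfig (Fin n)) := openConn o a₁ with hO₁
  set O₂ : Set (BondConfig (Fin n)) := openConn o a₂ with hO₂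
  set Ob : Set (BondConfig (Fin n)) := openConn o b with hOb
  set B₁ : Set (BondConfig (Fin n)) := openConn a₁ b with hB₁
  set B₂ : Set (BondConfig (Fin n)) := openConn a₂ b with hB₂
  set D : Set (BondConfig (Fin n)) := {ω | ¬ (openGraph ω).Reachable a₁ a₂} with hD
  set E : Set (BondConfig (Fin n)) := Ob ∩ (O₁ ∪ O₂) with hE
  set F₁ : Set (BondConfig (Fin n)) := (O₁ ∪ O₂) ∩ B₁ with hF₁
  set F₂ : Set (BondConfig (Fin n)) := (O₁ ∪ O₂) ∩ B₂ with hF₂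
  have hsplit : ∀ A S : Set (BondConfig (Fin n)), μ.real A = μ.real (A ∩ S) + μ.real (A ∩ Sᶜ) := by
    intro A S
    rw [← measureReal_inter_add_sdiff (s := A) (MeasurableSet.of_discrete : MeasurableSet S), Set.sdiff_eq]
  -- subtract-the-common-event identities (as in `KNPreFKG.preFKG_pair`)
  have hE1 : E ∩ O₁ = F₁ ∩ O₁ := by
    ext ω
    simp only [mem_inter_iff, mem_union, hE, hF₁, hO₁, hO₂, hOb, hB₁, openConn, mem_setOf_eq]
    constructor
    · rintro ⟨⟨hb, _⟩, h1⟩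
      exact ⟨⟨Or.inl h1, h1.symm.trans hb⟩, h1⟩
    · rintro ⟨⟨_, hb⟩, h1⟩
      exact ⟨⟨h1.trans hb, Or.inl h1⟩, h1⟩
  have hE1c : E ∩ O₁ᶜ = O₂ ∩ B₂ ∩ D := by
    ext ω
    simp only [mem_inter_iff, mem_union, mem_compl_iff, hE, hO₁, hO₂, hOb, hB₂, hD, openConn,
      mem_setOf_eq]
    constructor
    · rintro ⟨⟨hb, h1 | h2⟩, hn1⟩
      · exact absurd h1 hn1
      · exact ⟨⟨h2, h2.symm.trans hb⟩, fun h => hn1 (h2.trans h.symm)⟩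
    · rintro ⟨⟨h2, hb⟩, hn⟩
      exact ⟨⟨h2.trans hb, Or.inr h2⟩, fun h1 => hn (h1.symm.trans h2)⟩
  have hF1c : F₁ ∩ O₁ᶜ = O₂ ∩ B₁ ∩ D := by
    ext ω
    simp only [mem_inter_iff, mem_union, mem_compl_iff, hF₁, hO₁, hO₂, hB₁, hD, openConn,
      mem_setOf_eq]
    constructor
    · rintro ⟨⟨h1 | h2, hb⟩, hn1⟩
      · exact absurd h1 hn1
      · exact ⟨⟨h2, hb⟩, fun h => hn1 (h2.trans h.symm)⟩
    · rintro ⟨⟨h2, hb⟩, hn⟩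
      exact ⟨⟨Or.inr h2, hb⟩, fun h1 => hn (h1.symm.trans h2)⟩
  have hE2 : E ∩ O₂ = F₂ ∩ O₂ := by
    ext ω
    simp only [mem_inter_iff, mem_union, hE, hF₂, hO₁, hO₂, hOb, hB₂, openConn, mem_setOf_eq]
    constructor
    · rintro ⟨⟨hb, _⟩, h2⟩
      exact ⟨⟨Or.inr h2, h2.symm.trans hb⟩, h2⟩
    · rintro ⟨⟨_, hb⟩, h2⟩
      exact ⟨⟨h2.trans hb, Or.inr h2⟩, h2⟩
  have hE2c : E ∩ O₂ᶜ = O₁ ∩ B₁ ∩ D := by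
    ext ω
    simp only [mem_inter_iff, mem_union, mem_compl_iff, hE, hO₁, hO₂, hOb, hB₁, hD, openConn,
      mem_setOf_eq]
    constructor
    · rintro ⟨⟨hb, h1 | h2⟩, hn2⟩
      · exact ⟨⟨h1, h1.symm.trans hb⟩, fun h => hn2 (h1.trans h)⟩
      · exact absurd h2 hn2
    · rintro ⟨⟨h1, hb⟩, hn⟩
      exact ⟨⟨h1.trans hb, Or.inl h1⟩, fun h2 => hn (h1.symm.trans h2)⟩
  have hF2c : F₂ ∩ O₂ᶜ = O₁ ∩ B₂ ∩ D := by
    ext ω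
    simp only [mem_inter_iff, mem_union, mem_compl_iff, hF₂, hO₁, hO₂, hB₂, hD, openConn,
      mem_setOf_eq]
    constructor
    · rintro ⟨⟨h1 | h2, hb⟩, hn2⟩
      · exact ⟨⟨h1, hb⟩, fun h => hn2 (h1.trans h)⟩
      · exact absurd h2 hn2
    · rintro ⟨⟨h1, hb⟩, hn⟩
      exact ⟨⟨Or.inl h1, hb⟩, fun h2 => hn (h1.symm.trans h2)⟩
  have hdiff1 : μ.real E - μ.real F₁ = μ.real (O₂ ∩ B₂ ∩ D) - μ.real (O₂ ∩ B₁ ∩ D) := by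
    rw [hsplit E O₁, hsplit F₁ O₁, hE1, hE1c, hF1c]
    ring
  have hdiff2 : μ.real E - μ.real F₂ = μ.real (O₁ ∩ B₁ ∩ D) - μ.real (O₁ ∩ B₂ ∩ D) := by
    rw [hsplit E O₂, hsplit F₂ O₂, hE2, hE2c, hF2c]
    ring
  -- the four BHK inequalities, given `D = {a₁ ↮ a₂}`
  have hD1 : {ω : BondConfig (Fin n) | ∀ x ∈ ({a₂} : Set (Fin n)), ¬ (openGraph ω).Reachable a₁ x} = D := by
    ext ω
    simp [hD]
  have hD2 : {ω : BondConfig (Fin n) | ∀ x ∈ ({a₁} : Set (Fin n)), ¬ (openGraph ω).Reachable a₂ x} = D := by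
    ext ω
    simp only [mem_setOf_eq, mem_singleton_iff, forall_eq, hD]
    exact not_congr ⟨SimpleGraph.Reachable.symm, SimpleGraph.Reachable.symm⟩
  have hD3 : {ω : BondConfig (Fin n) | ¬ (openGraph ω).Reachable a₂ a₁} = D := by
    ext ω
    simp only [mem_setOf_eq, hD]
    exact not_congr ⟨SimpleGraph.Reachable.symm, SimpleGraph.Reachable.symm⟩
  have h_i := bhk_one_upper_upper w a₂ ({a₁} : Set (Fin n)) (by simpa using Ne.symm h12)
    (isUpperSet_connFamily a₂ o) (isUpperSet_connFamily a₂ b)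
  rw [hD2, ← openConn_eq_setOf_connFamily, ← openConn_eq_setOf_connFamily, openConn_symm a₂ o] at h_i
  have h_ii := bhk_two_upper_upper w a₂ a₁ (Ne.symm h12) (isUpperSet_connFamily a₂ o)
    (isUpperSet_connFamily a₁ b)
  rw [hD3, ← openConn_eq_setOf_connFamily, ← openConn_eq_setOf_connFamily, openConn_symm a₂ o] at h_ii
  have h_iii := bhk_one_upper_upper w a₁ ({a₂} : Set (Fin n)) (by simpa using h12)
    (isUpperSet_connFamily a₁ o) (isUpperSet_connFamily a₁ b)
  rw [hD1, ← openConn_eq_setOf_connFamily, ← openConn_eq_setOf_connFamily, openConn_symm a₁ o] at h_iii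
  have h_iv := bhk_two_upper_upper w a₁ a₂ h12 (isUpperSet_connFamily a₁ o)
    (isUpperSet_connFamily a₂ b)
  rw [← openConn_eq_setOf_connFamily, ← openConn_eq_setOf_connFamily, openConn_symm a₁ o] at h_iv
  have e1 : D ∩ (O₂ ∩ B₂) = O₂ ∩ B₂ ∩ D := inter_comm _ _
  have e2 : D ∩ (O₂ ∩ B₁) = O₂ ∩ B₁ ∩ D := inter_comm _ _
  have e3 : D ∩ (O₁ ∩ B₁) = O₁ ∩ B₁ ∩ D := inter_comm _ _
  have e4 : D ∩ (O₁ ∩ B₂) = O₁ ∩ B₂ ∩ D := inter_comm _ _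
  simp only [← hD, ← hO₁, ← hO₂, ← hB₁, ← hB₂] at h_i h_ii h_iii h_iv
  rw [e1] at h_i
  rw [e2] at h_ii
  rw [e3] at h_iii
  rw [e4] at h_iv
  -- KN's weighted inequality (6), denominators cleared:  (φ₁+φ₂) μ(E) ≥ φ₁ μ(F₁) + φ₂ μ(F₂)
  have h6 : (μ.real (D ∩ O₁) + μ.real (D ∩ O₂)) * μ.real E ≥
      μ.real (D ∩ O₁) * μ.real F₁ + μ.real (D ∩ O₂) * μ.real F₂ := by
    by_cases hD0 : μ.real D = 0
    · have hz : ∀ A : Set (BondConfig (Fin n)), μ.real (D ∩ A) = 0 := fun A =>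
        le_antisymm ((measureReal_mono inter_subset_left).trans hD0.le) measureReal_nonneg
      rw [hz, hz]; simp
    · have hDpos : 0 < μ.real D := lt_of_le_of_ne measureReal_nonneg (Ne.symm hD0)
      have k1 : μ.real D * (μ.real (D ∩ O₁) * (μ.real E - μ.real F₁)) ≥
          μ.real (D ∩ O₁) * (μ.real (D ∩ O₂) * (μ.real (D ∩ B₂) - μ.real (D ∩ B₁))) := by
        rw [hdiff1]
        have hs : 0 ≤ μ.real (D ∩ O₁) := measureReal_nonneg
        nlinarith [h_i, h_ii, hs]
      have k2 : μ.real D * (μ.real (D ∩ O₂) * (μ.real E - μ.real F₂)) ≥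
          μ.real (D ∩ O₂) * (μ.real (D ∩ O₁) * (μ.real (D ∩ B₁) - μ.real (D ∩ B₂))) := by
        rw [hdiff2]
        have hs : 0 ≤ μ.real (D ∩ O₂) := measureReal_nonneg
        nlinarith [h_iii, h_iv, hs]
      have k3 : μ.real D * ((μ.real (D ∩ O₁) + μ.real (D ∩ O₂)) * μ.real E -
          (μ.real (D ∩ O₁) * μ.real F₁ + μ.real (D ∩ O₂) * μ.real F₂)) ≥ 0 := by
        nlinarith [k1, k2]
      nlinarith [k3, hDpos]
  -- Harris: μ(F_i) ≥ μ(O₁ ∪ O₂) μ(B_i)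
  have hU : IsUpperSet (O₁ ∪ O₂) := (isUpperSet_openConn o a₁).union (isUpperSet_openConn o a₂)
  have hH1 : μ.real (O₁ ∪ O₂) * μ.real B₁ ≤ μ.real F₁ :=
    prodBernoulli_harris w hU (isUpperSet_openConn a₁ b) MeasurableSet.of_discrete MeasurableSet.of_discrete
  have hH2 : μ.real (O₁ ∪ O₂) * μ.real B₂ ≤ μ.real F₂ :=
    prodBernoulli_harris w hU (isUpperSet_openConn a₂ b) MeasurableSet.of_discrete MeasurableSet.of_discrete
  -- bookkeeping: μ(O₂ ∩ O₁ᶜ) = μ(D ∩ O₂), μ(O₁ ∪ O₂) = μ(O₁) + μ(D ∩ O₂) ≥ φ₁ + φ₂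
  have hO2c : O₂ ∩ O₁ᶜ = D ∩ O₂ := by
    ext ω
    simp only [mem_inter_iff, mem_compl_iff, hO₁, hO₂, hD, openConn, mem_setOf_eq]
    constructor
    · rintro ⟨h2, hn1⟩
      exact ⟨fun h => hn1 (h2.trans h.symm), h2⟩
    · rintro ⟨hn, h2⟩
      exact ⟨h2, fun h1 => hn (h1.symm.trans h2)⟩
  have hPA : μ.real (O₁ ∪ O₂) = μ.real O₁ + μ.real (D ∩ O₂) := by
    rw [hsplit (O₁ ∪ O₂) O₁, ← hO2c]
    congr 1
    · rw [union_inter_cancel_left]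
    · congr 1
      ext ω
      simp only [mem_inter_iff, mem_union, mem_compl_iff]
      tauto
  have hphi1 : μ.real (D ∩ O₁) ≤ μ.real O₁ := measureReal_mono inter_subset_right
  have hS_le : μ.real (D ∩ O₁) + μ.real (D ∩ O₂) ≤ μ.real (O₁ ∪ O₂) := by
    rw [hPA]; linarith
  -- case analysis on S = φ₁ + φ₂
  have hφ1 : 0 ≤ μ.real (D ∩ O₁) := measureReal_nonneg
  have hφ2 : 0 ≤ μ.real (D ∩ O₂) := measureReal_nonneg
  have hp1 : 0 ≤ μ.real B₁ := measureReal_nonneg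
  have hEsub : μ.real (O₁ ∩ B₁) ≤ μ.real E := by
    refine measureReal_mono ?_
    rintro ω ⟨h1, hb⟩
    exact ⟨(h1 : (openGraph ω).Reachable o a₁).trans hb, Or.inl h1⟩
  have hHO1 : μ.real O₁ * μ.real B₁ ≤ μ.real (O₁ ∩ B₁) :=
    prodBernoulli_harris w (isUpperSet_openConn o a₁) (isUpperSet_openConn a₁ b)
      MeasurableSet.of_discrete MeasurableSet.of_discrete
  rw [hO2c]
  by_cases hS : μ.real (D ∩ O₁) + μ.real (D ∩ O₂) = 0
  · have hφ2z : μ.real (D ∩ O₂) = 0 := by linarith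
    rw [hφ2z, zero_mul, add_zero]
    exact hHO1.trans hEsub
  · have hSpos : 0 < μ.real (D ∩ O₁) + μ.real (D ∩ O₂) := lt_of_le_of_ne (by linarith) (Ne.symm hS)
    -- S μE ≥ φ₁ P_A p₁ + φ₂ P_A p₂ ≥ S (μ(O₁) p₁ + φ₂ p₂)
    have hdp : 0 ≤ μ.real B₂ - μ.real B₁ := by linarith
    have key : (μ.real (D ∩ O₁) + μ.real (D ∩ O₂)) * μ.real E ≥
        (μ.real (D ∩ O₁) + μ.real (D ∩ O₂)) *
          (μ.real O₁ * μ.real B₁ + μ.real (D ∩ O₂) * μ.real B₂) := by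
      have t1 : μ.real (D ∩ O₁) * μ.real F₁ + μ.real (D ∩ O₂) * μ.real F₂ ≥
          μ.real (O₁ ∪ O₂) * (μ.real (D ∩ O₁) * μ.real B₁ + μ.real (D ∩ O₂) * μ.real B₂) := by
        nlinarith [hH1, hH2, hφ1, hφ2]
      have t2 : μ.real (O₁ ∪ O₂) * (μ.real (D ∩ O₁) * μ.real B₁ + μ.real (D ∩ O₂) * μ.real B₂) =
          μ.real (O₁ ∪ O₂) * ((μ.real (D ∩ O₁) + μ.real (D ∩ O₂)) * μ.real B₁ +
            μ.real (D ∩ O₂) * (μ.real B₂ - μ.real B₁)) := by ring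
      have t3 : μ.real (O₁ ∪ O₂) * (μ.real (D ∩ O₂) * (μ.real B₂ - μ.real B₁)) ≥
          (μ.real (D ∩ O₁) + μ.real (D ∩ O₂)) * (μ.real (D ∩ O₂) * (μ.real B₂ - μ.real B₁)) :=
        mul_le_mul_of_nonneg_right hS_le (mul_nonneg hφ2 hdp)
      have t4 : (μ.real (D ∩ O₁) + μ.real (D ∩ O₂)) *
          (μ.real O₁ * μ.real B₁ + μ.real (D ∩ O₂) * μ.real B₂) =
          (μ.real (D ∩ O₁) + μ.real (D ∩ O₂)) * (μ.real (O₁ ∪ O₂) * μ.real B₁) +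
            (μ.real (D ∩ O₁) + μ.real (D ∩ O₂)) * (μ.real (D ∩ O₂) * (μ.real B₂ - μ.real B₁)) := by
        rw [hPA]; ring
      nlinarith [h6, t1, t2, t3, t4]
    exact le_of_mul_le_mul_left (by linarith [key]) hSpos

/-- **The selection inequality (SO_ρ) for `|A ∖ a₁| = 2` at levels `j ≥ 2`, ranking the LESS reliable relay
first.**  With `A ∖ a₁ = {b₁, b₂}`, `ρ b₁ < ρ b₂`, `μ(b₁ ↔ a₁) ≤ μ(b₂ ↔ a₁)` and `2 ≤ j`, the hypothesis of
`avoidingMax_of_selectionOrder` holds: `Σ_b μ(E_b ∩ F_b) ≤ Σ_b μ(E_b) μ(F_b)` — here `E_{b₁} = {o ↔ b₁}`,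
`E_{b₂} = {o ↔ b₂, o ↮ b₁}`, `F_b = {b ↮ a₁}` (the light condition `M_b ≤ j` is automatic on `{b ↮ a₁}`), and the
inequality is `averagedPostFKG_pair` for the target `a₁` after passing to complements. [this work] -/
theorem selectionOrder_three (w : Sym2 (Fin n) → unitInterval) (A : Finset (Fin n)) (o a₁ b₁ b₂ : Fin n)
    (j : ℕ) (hAb : A.erase a₁ = {b₁, b₂}) (h12 : b₁ ≠ b₂) (hj : 2 ≤ j) (ρ : Fin n → ℕ) (hρ : ρ b₁ < ρ b₂)
    (hp : (prodBernoulli w).real (openConn b₁ a₁) ≤ (prodBernoulli w).real (openConn b₂ a₁)) :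
    ∑ b ∈ A.erase a₁, (prodBernoulli w).real
        ((openConn o b ∩ {ω : BondConfig (Fin n) | ∀ c ∈ A.erase a₁, ρ c < ρ b → ω ∉ openConn o c}) ∩
          {ω : BondConfig (Fin n) | ω ∉ openConn b a₁ ∧ (A.filter fun x => ω ∈ openConn b x).card ≤ j}) ≤
      ∑ b ∈ A.erase a₁, (prodBernoulli w).real
          (openConn o b ∩ {ω : BondConfig (Fin n) | ∀ c ∈ A.erase a₁, ρ c < ρ b → ω ∉ openConn o c}) *
        (prodBernoulli w).real
          {ω : BondConfig (Fin n) | ω ∉ openConn b a₁ ∧ (A.filter fun x => ω ∈ openConn b x).card ≤ j} := by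
  set μ := prodBernoulli w with hμ
  -- at these levels the light-and-avoid event is `{b ↮ a₁}`
  have hF : ∀ b : Fin n,
      {ω : BondConfig (Fin n) | ω ∉ openConn b a₁ ∧ (A.filter fun x => ω ∈ openConn b x).card ≤ j} =
        (openConn b a₁)ᶜ := by
    intro b
    ext ω
    simp only [mem_setOf_eq, mem_compl_iff, and_iff_left_iff_imp]
    intro hna
    have hsub : (A.filter fun x => ω ∈ openConn b x) ⊆ A.erase a₁ := by
      intro x hx
      obtain ⟨hxA, hbx⟩ := Finset.mem_filter.1 hx
      exact Finset.mem_erase.2 ⟨fun h => hna (h ▸ hbx), hxA⟩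
    calc (A.filter fun x => ω ∈ openConn b x).card ≤ (A.erase a₁).card := Finset.card_le_card hsub
      _ = 2 := by rw [hAb]; exact Finset.card_pair h12
      _ ≤ j := hj
  simp only [hF]
  rw [hAb, Finset.sum_pair h12, Finset.sum_pair h12]
  -- the first-reached events
  have hE1 : openConn o b₁ ∩
      {ω : BondConfig (Fin n) | ∀ c ∈ ({b₁, b₂} : Finset (Fin n)), ρ c < ρ b₁ → ω ∉ openConn o c} =
        openConn o b₁ := by
    ext ω
    simp only [mem_inter_iff, mem_setOf_eq, and_iff_left_iff_imp]
    intro _ c hc hlt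
    rw [Finset.mem_insert, Finset.mem_singleton] at hc
    rcases hc with rfl | rfl
    · exact absurd hlt (lt_irrefl _)
    · exact absurd hlt (not_lt.2 hρ.le)
  have hE2 : openConn o b₂ ∩
      {ω : BondConfig (Fin n) | ∀ c ∈ ({b₁, b₂} : Finset (Fin n)), ρ c < ρ b₂ → ω ∉ openConn o c} =
        openConn o b₂ ∩ (openConn o b₁)ᶜ := by
    ext ω
    simp only [mem_inter_iff, mem_setOf_eq, mem_compl_iff]
    constructor
    · rintro ⟨h2, h⟩
      exact ⟨h2, h b₁ (by simp) hρ⟩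
    · rintro ⟨h2, hn1⟩
      refine ⟨h2, fun c hc hlt => ?_⟩
      rw [Finset.mem_insert, Finset.mem_singleton] at hc
      rcases hc with rfl | rfl
      · exact hn1
      · exact absurd hlt (lt_irrefl _)
  rw [hE1, hE2]
  -- pass to complements
  set O₁ : Set (BondConfig (Fin n)) := openConn o b₁ with hO₁
  set O₂ : Set (BondConfig (Fin n)) := openConn o b₂ with hO₂
  set B₁ : Set (BondConfig (Fin n)) := openConn b₁ a₁ with hB₁
  set B₂ : Set (BondConfig (Fin n)) := openConn b₂ a₁ with hB₂
  have hsplit : ∀ S T : Set (BondConfig (Fin n)), μ.real S = μ.real (S ∩ T) + μ.real (S ∩ Tᶜ) := by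
    intro S T
    rw [← measureReal_inter_add_sdiff (s := S) (MeasurableSet.of_discrete : MeasurableSet T), Set.sdiff_eq]
  have hc1 : μ.real B₁ᶜ = 1 - μ.real B₁ := probReal_compl_eq_one_sub MeasurableSet.of_discrete
  have hc2 : μ.real B₂ᶜ = 1 - μ.real B₂ := probReal_compl_eq_one_sub MeasurableSet.of_discrete
  have hs1 : μ.real (O₁ ∩ B₁ᶜ) = μ.real O₁ - μ.real (O₁ ∩ B₁) := by
    have := hsplit O₁ B₁; linarith
  have hs2 : μ.real (O₂ ∩ O₁ᶜ ∩ B₂ᶜ) = μ.real (O₂ ∩ O₁ᶜ) - μ.real (O₂ ∩ O₁ᶜ ∩ B₂) := by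
    have := hsplit (O₂ ∩ O₁ᶜ) B₂; linarith
  -- the averaged post-FKG inequality for the target `a₁`, and the identity for its left side
  have key := averagedPostFKG_pair w o a₁ b₁ b₂ h12 hp
  have hid : μ.real (openConn o a₁ ∩ (O₁ ∪ O₂)) = μ.real (O₁ ∩ B₁) + μ.real (O₂ ∩ O₁ᶜ ∩ B₂) := by
    rw [hsplit (openConn o a₁ ∩ (O₁ ∪ O₂)) O₁]
    congr 1
    · congr 1
      ext ω
      simp only [mem_inter_iff, mem_union, hO₁, hO₂, hB₁, openConn, mem_setOf_eq]
      constructor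
      · rintro ⟨⟨ha, _⟩, h1⟩
        exact ⟨h1, h1.symm.trans ha⟩
      · rintro ⟨h1, hb⟩
        exact ⟨⟨h1.trans hb, Or.inl h1⟩, h1⟩
    · congr 1
      ext ω
      simp only [mem_inter_iff, mem_union, mem_compl_iff, hO₁, hO₂, hB₂, openConn, mem_setOf_eq]
      constructor
      · rintro ⟨⟨ha, h1 | h2⟩, hn1⟩
        · exact absurd h1 hn1
        · exact ⟨⟨h2, hn1⟩, h2.symm.trans ha⟩
      · rintro ⟨⟨h2, hn1⟩, hb⟩
        exact ⟨⟨h2.trans hb, Or.inr h2⟩, hn1⟩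
  simp only [← hO₁, ← hO₂, ← hB₁, ← hB₂] at key
  rw [hid] at key
  rw [hs1, hs2, hc1, hc2]
  nlinarith [key]

/-- **(IG₁) for `|A| = 3` at levels `j ≥ 2` via SELECTION** (a second proof of this instance of Kozma–Nitzan's
Theorem 7, now through the selection inequality): `μ(1 ≤ N ≤ j, o ↮ a₁) ≤ μ(b ↮ a₁, M_b ≤ j)` for some
`b ∈ A ∖ a₁`. [this work] -/
theorem avoidingMax_card_three_top (w : Sym2 (Fin n) → unitInterval) (A : Finset (Fin n)) (o a₁ : Fin n)
    (j : ℕ) (ha₁ : a₁ ∈ A) (h3 : A.card = 3) (hj : 2 ≤ j) :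
    ∃ b ∈ A.erase a₁,
      (prodBernoulli w).real {ω : BondConfig (Fin n) |
          1 ≤ (A.filter fun x => ω ∈ openConn o x).card ∧ (A.filter fun x => ω ∈ openConn o x).card ≤ j ∧
            ω ∉ openConn o a₁} ≤
        (prodBernoulli w).real {ω : BondConfig (Fin n) |
          ω ∉ openConn b a₁ ∧ (A.filter fun x => ω ∈ openConn b x).card ≤ j} := by
  have hcard : (A.erase a₁).card = 2 := by rw [Finset.card_erase_of_mem ha₁, h3]
  obtain ⟨x, y, hxy, hxy'⟩ := Finset.card_eq_two.1 hcard
  -- order the two relays: the less reliable one (towards `a₁`) first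
  rcases le_total ((prodBernoulli w).real (openConn x a₁)) ((prodBernoulli w).real (openConn y a₁)) with hle | hle
  · set ρ : Fin n → ℕ := fun v => if v = x then 0 else 1 with hρdef
    have hρ : ρ x < ρ y := by simp [hρdef, hxy.symm]
    have hinj : Set.InjOn ρ ↑(A.erase a₁) := by
      rw [hxy', Finset.coe_insert, Finset.coe_singleton]
      intro u hu v hv huv
      simp only [Set.mem_insert_iff, Set.mem_singleton_iff] at hu hv
      rcases hu with rfl | rfl <;> rcases hv with rfl | rfl
      · rfl
      · simp [hρdef, hxy.symm] at huv
      · simp [hρdef, hxy.symm] at huv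
      · rfl
    exact avoidingMax_of_selectionOrder w A o a₁ j ha₁ (by omega) ρ hinj
      (selectionOrder_three w A o a₁ x y j hxy' hxy hj ρ hρ hle)
  · set ρ : Fin n → ℕ := fun v => if v = y then 0 else 1 with hρdef
    have hρ : ρ y < ρ x := by simp [hρdef, hxy]
    have hyx' : A.erase a₁ = {y, x} := by rw [hxy', Finset.pair_comm]
    have hinj : Set.InjOn ρ ↑(A.erase a₁) := by
      rw [hxy', Finset.coe_insert, Finset.coe_singleton]
      intro u hu v hv huv
      simp only [Set.mem_insert_iff, Set.mem_singleton_iff] at hu hv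
      rcases hu with rfl | rfl <;> rcases hv with rfl | rfl
      · rfl
      · simp [hρdef, hxy] at huv
      · simp [hρdef, hxy] at huv
      · rfl
    exact avoidingMax_of_selectionOrder w A o a₁ j ha₁ (by omega) ρ hinj
      (selectionOrder_three w A o a₁ y x j hyx' hxy.symm hj ρ hρ hle)

end SelectionOrder

end Summit.CriticalPhenomena.PercolationContinuityZ3.Theorems

end
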